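import Literature.MathematicalPhysics.QuantumLattice.GrassmannWeightedTruncatedBound
import Literature.MathematicalPhysics.QuantumLattice.GrassmannCumulantActionBound
import HarnessLib

/-!
# The decay-weighted `L¹–L^∞` bound for the kernels of `𝓔ᵀ_C(V; n)`

Topic `Literature/MathematicalPhysics/QuantumLattice`; the WEIGHTED form of `GrassmannCumulantKernelBound.lean` and
`GrassmannCumulantActionBound.lean` (Benfatto–Giuliani–Mastropietro 2006, (2.13)–(2.14) with (2.77)–(2.80) and §3
(3.2)–(3.8): position-space moments of the kernels of the effective potentials; Gentile–Mastropietro 2001, §4).  For a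
tree weight `wt` on label sets (`SubmultiplicativeTreeWeight.lean`), an even element `V = Σ_{m'} Σ_Y K_{m'}(Y) ψ(Y)`
(degrees `2m'`) whose kernels have `wt`-WEIGHTED anchored `L¹` norms `≤ N_{m'}`, and a charged covariance in Gram form
(constant `κ`) whose row and column sums against the pair weights `wt {X, Y}` are at most `α`, the kernels of the
`n`-th truncated expectation obey, one output label pinned, the others summed against the weight of the output label
set,

`Σ_{W : W_i = w} wt(W) ‖kernel_r 𝓔ᵀ_C(V; n) (W)‖ ≤ n! · ρ^{-r} κ^{-2(n-1)} α^{n-1} eⁿ · (Σ_{m'} (e²(κ+ρ))^{2m'} N_{m'})ⁿ`: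

the same constants as without weights (`sum_norm_kernel_cumulantOf_le_pow`), with `N` and `α` replaced by their
weighted versions.  The proof is that of the unweighted files: replicas (the weight is pulled back to the replica
labels along `(a, X) ↦ X`, `IsTreeWeight.comap`), the weighted bound of `GrassmannWeightedTruncatedBound.lean` for
each degree assignment, collapse.

* `sum_filter_wt_norm_kernel_collapse_le`, `sum_filter_wt_norm_replicaKer_le`, `sum_wt_norm_typeRestrict_submatrix_le(')`
  (the weighted replica bookkeeping);
* `sum_wt_norm_kernel_cumulantOf_le` (any `λ_δ`), `mul_sum_ite_cumulantBound_le` (the arithmetic of the standard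
  choice `λ_δ = 1/(α(N_δ + n))`), **`sum_wt_norm_kernel_cumulantOf_le_pow`**.

Everything is proved; no definition.

## Sources

G. Benfatto, A. Giuliani, V. Mastropietro, Ann. Henri Poincaré 7 (2006) 809–898, (2.13)–(2.14), (2.77)–(2.80), §3
(3.2)–(3.8) (`BenfattoGiulianiMastropietro2006`); G. Gentile, V. Mastropietro, Phys. Rep. 352 (2001) 273–437, §4
(`GentileMastropietro2001`); K. Gawȩdzki, A. Kupiainen, Comm. Math. Phys. 102 (1985) 1–30 (`GawedzkiKupiainen1985GrossNeveu`).
-/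

noncomputable section

namespace Literature.MathematicalPhysics.QuantumLattice

open GrassmannAlgebra Finset Literature.Probability.LatticeModels Literature.Probability.LatticeModels.BattleFederbush
open scoped InnerProductSpace

variable {𝕜 : Type*} [RCLike 𝕜] {Γ : Type*} [Fintype Γ] [DecidableEq Γ] {n : ℕ} {wt : Finset Γ → ℝ}

/-! ### The weighted replica bookkeeping -/

/-- **The weighted pinned sums of the kernels of a collapsed element**:
`Σ_{X : X_i = w} wt(X) ‖kernel (collapse snd F) m X‖ ≤ Σ_b Σ_{X' : X'_i = (b, w)} wt(snd X') ‖kernel F m X'‖`. [folklore] -/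
theorem sum_filter_wt_norm_kernel_collapse_le (hwt : IsTreeWeight wt) (F : GrassmannAlgebra 𝕜 (Fin n × Γ)) {m : ℕ} (i : Fin m) (w : Γ) :
    ∑ X ∈ univ.filter (fun X : Fin m → Γ => X i = w), wt (univ.image X) * ‖kernel 𝕜 (collapse 𝕜 (Prod.snd : Fin n × Γ → Γ) F) m X‖ ≤
      ∑ b : Fin n, ∑ X' ∈ univ.filter (fun X' : Fin m → Fin n × Γ => X' i = (b, w)),
        wt ((univ.image X').image Prod.snd) * ‖kernel 𝕜 F m X'‖ := by
  have himg : ∀ (X : Fin m → Γ) (X' : Fin m → Fin n × Γ), (∀ j, (X' j).2 = X j) → (univ.image X').image Prod.snd = univ.image X := by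
    intro X X' h
    rw [image_image, show Prod.snd ∘ X' = X from funext h]
  calc ∑ X ∈ univ.filter (fun X : Fin m → Γ => X i = w), wt (univ.image X) * ‖kernel 𝕜 (collapse 𝕜 (Prod.snd : Fin n × Γ → Γ) F) m X‖
      ≤ ∑ X ∈ univ.filter (fun X : Fin m → Γ => X i = w),
          ∑ X' ∈ univ.filter (fun X' : Fin m → Fin n × Γ => ∀ j, (X' j).2 = X j), wt ((univ.image X').image Prod.snd) * ‖kernel 𝕜 F m X'‖ := by
        refine sum_le_sum fun X _ => ?_
        rw [kernel_collapse]
        refine (mul_le_mul_of_nonneg_left (norm_sum_le _ _) (hwt.nonneg _)).trans (le_of_eq ?_)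
        rw [mul_sum]
        exact sum_congr rfl fun X' hX' => by rw [himg X X' (mem_filter.1 hX').2]
    _ = ∑ X ∈ univ.filter (fun X : Fin m → Γ => X i = w),
          ∑ X' ∈ (univ.filter fun X' : Fin m → Fin n × Γ => (X' i).2 = w).filter (fun X' => (fun j => (X' j).2) = X),
            wt ((univ.image X').image Prod.snd) * ‖kernel 𝕜 F m X'‖ := by
        refine sum_congr rfl fun X hX => sum_congr ?_ fun _ _ => rfl
        ext X'
        simp only [mem_filter, mem_univ, true_and, funext_iff]
        constructor
        · intro h
          exact ⟨by rw [h i]; exact (mem_filter.1 hX).2, h⟩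
        · exact fun h => h.2
    _ = ∑ X' ∈ univ.filter (fun X' : Fin m → Fin n × Γ => (X' i).2 = w), wt ((univ.image X').image Prod.snd) * ‖kernel 𝕜 F m X'‖ := by
        refine sum_fiberwise_of_maps_to (fun X' hX' => ?_) _
        rw [mem_filter] at hX' ⊢
        exact ⟨mem_univ _, hX'.2⟩
    _ = ∑ b : Fin n, ∑ X' ∈ (univ.filter fun X' : Fin m → Fin n × Γ => (X' i).2 = w).filter (fun X' => (X' i).1 = b),
          wt ((univ.image X').image Prod.snd) * ‖kernel 𝕜 F m X'‖ :=
        (sum_fiberwise _ (fun X' : Fin m → Fin n × Γ => (X' i).1) _).symm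
    _ = ∑ b : Fin n, ∑ X' ∈ univ.filter (fun X' : Fin m → Fin n × Γ => X' i = (b, w)),
          wt ((univ.image X').image Prod.snd) * ‖kernel 𝕜 F m X'‖ := by
        refine sum_congr rfl fun b _ => sum_congr ?_ fun _ _ => rfl
        ext X'
        simp only [mem_filter, mem_univ, true_and, Prod.ext_iff]
        tauto

/-- **The weighted anchored sums of a replica kernel are those of the kernel.** [folklore] -/
theorem sum_filter_wt_norm_replicaKer_le (hwt : IsTreeWeight wt) {m : ℕ} (K : (Fin m → Γ) → 𝕜) (a : Fin n) {N : ℝ}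
    (hN : ∀ (j : Fin m) (w : Γ), ∑ Y ∈ univ.filter (fun Y : Fin m → Γ => Y j = w), ‖K Y‖ * wt (univ.image Y) ≤ N)
    (j : Fin m) (bw : Fin n × Γ) :
    ∑ Y' ∈ univ.filter (fun Y' : Fin m → Fin n × Γ => Y' j = bw), ‖replicaKer 𝕜 K a Y'‖ * wt ((univ.image Y').image Prod.snd) ≤ N := by
  have hzero : ∀ Y' : Fin m → Fin n × Γ, Y' ∉ univ.map (copyEmb a) → ‖replicaKer 𝕜 K a Y'‖ * wt ((univ.image Y').image Prod.snd) = 0 := by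
    intro Y' hY'
    rw [← filter_forall_fst_eq, mem_filter, not_and] at hY'
    rw [replicaKer, if_neg (hY' (mem_univ _)), norm_zero, zero_mul]
  have himg : ∀ Y : Fin m → Γ, (univ.image (copyEmb (n := n) a Y)).image Prod.snd = univ.image Y := fun Y => by
    rw [image_image]; rfl
  calc ∑ Y' ∈ univ.filter (fun Y' : Fin m → Fin n × Γ => Y' j = bw), ‖replicaKer 𝕜 K a Y'‖ * wt ((univ.image Y').image Prod.snd)
      = ∑ Y' ∈ (univ.map (copyEmb (m := m) a)).filter (fun Y' => Y' j = bw), ‖replicaKer 𝕜 K a Y'‖ * wt ((univ.image Y').image Prod.snd) := by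
        symm
        refine sum_subset (filter_subset_filter _ (subset_univ _)) fun Y' hY' hY'2 => hzero Y' fun hmem => ?_
        exact hY'2 (mem_filter.2 ⟨hmem, (mem_filter.1 hY').2⟩)
    _ = ∑ Y ∈ univ.filter (fun Y : Fin m → Γ => copyEmb (n := n) a Y j = bw), ‖K Y‖ * wt (univ.image Y) := by
        rw [filter_map, sum_map]
        exact sum_congr rfl fun Y _ => by rw [replicaKer_copyEmb, himg]
    _ ≤ ∑ Y ∈ univ.filter (fun Y : Fin m → Γ => Y j = bw.2), ‖K Y‖ * wt (univ.image Y) := by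
        refine sum_le_sum_of_subset_of_nonneg (fun Y hY => ?_) fun _ _ _ => mul_nonneg (norm_nonneg _) (hwt.nonneg _)
        rw [mem_filter] at hY ⊢
        exact ⟨mem_univ _, by rw [← hY.2]; rfl⟩
    _ ≤ N := hN j bw.2

omit [DecidableEq Γ] in
/-- **The weighted row sums of the type-restricted replica-blind covariance are one-copy weighted row sums.** [folklore] -/
theorem sum_wt_norm_typeRestrict_submatrix_le [DecidableEq Γ] (C : Matrix Γ Γ 𝕜) {α : ℝ} (hα : 0 ≤ α)
    (hrow : ∀ X, ∑ Y, ‖C X Y‖ * wt {X, Y} ≤ α) (ℓ : Sym2 (Fin n)) (X' : Fin n × Γ) :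
    ∑ Y' : Fin n × Γ, ‖typeRestrict (C.submatrix Prod.snd Prod.snd) Prod.fst ℓ X' Y'‖ * wt (({X', Y'} : Finset (Fin n × Γ)).image Prod.snd) ≤ α := by
  rw [Fintype.sum_prod_type]
  simp only [typeRestrict_apply, Matrix.submatrix_apply, image_insert, image_singleton]
  have hb : ∀ b : Fin n, ∑ Y : Γ, ‖(if s(X'.1, b) = ℓ then C X'.2 Y else 0 : 𝕜)‖ * wt {X'.2, Y} =
      if s(X'.1, b) = ℓ then ∑ Y, ‖C X'.2 Y‖ * wt {X'.2, Y} else 0 := by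
    intro b
    split_ifs <;> simp
  simp only [hb]
  by_cases h : ∃ b, s(X'.1, b) = ℓ
  · obtain ⟨b₀, hb₀⟩ := h
    rw [Fintype.sum_eq_single b₀ fun b hb' => if_neg fun hb'' => hb' (Sym2.congr_right.1 (hb''.trans hb₀.symm)), if_pos hb₀]
    exact hrow _
  · rw [Fintype.sum_eq_zero _ fun b => if_neg fun hb' => h ⟨b, hb'⟩]
    exact hα

omit [DecidableEq Γ] in
/-- … and the weighted column sums are one-copy weighted column sums. [folklore] -/
theorem sum_wt_norm_typeRestrict_submatrix_le' [DecidableEq Γ] (C : Matrix Γ Γ 𝕜) {α : ℝ} (hα : 0 ≤ α)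
    (hcol : ∀ Y, ∑ X, ‖C X Y‖ * wt {X, Y} ≤ α) (ℓ : Sym2 (Fin n)) (Y' : Fin n × Γ) :
    ∑ X' : Fin n × Γ, ‖typeRestrict (C.submatrix Prod.snd Prod.snd) Prod.fst ℓ X' Y'‖ * wt (({X', Y'} : Finset (Fin n × Γ)).image Prod.snd) ≤ α := by
  rw [Fintype.sum_prod_type]
  simp only [typeRestrict_apply, Matrix.submatrix_apply, image_insert, image_singleton]
  have hb : ∀ b : Fin n, ∑ X : Γ, ‖(if s(b, Y'.1) = ℓ then C X Y'.2 else 0 : 𝕜)‖ * wt {X, Y'.2} =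
      if s(b, Y'.1) = ℓ then ∑ X, ‖C X Y'.2‖ * wt {X, Y'.2} else 0 := by
    intro b
    split_ifs <;> simp
  simp only [hb]
  by_cases h : ∃ b, s(b, Y'.1) = ℓ
  · obtain ⟨b₀, hb₀⟩ := h
    rw [Fintype.sum_eq_single b₀ fun b hb' => if_neg fun hb'' => hb' (Sym2.congr_left.1 (hb''.trans hb₀.symm)), if_pos hb₀]
    exact hcol _
  · rw [Fintype.sum_eq_zero _ fun b => if_neg fun hb' => h ⟨b, hb'⟩]
    exact hα

/-! ### The weighted bound for `𝓔ᵀ_C(V; n)` -/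

section Main

variable (C : Matrix Γ Γ 𝕜)

/-- **The decay-weighted `L¹–L^∞` bound for the kernels of `𝓔ᵀ_C(V; n)`** (Benfatto–Giuliani–Mastropietro 2006,
(2.13)–(2.14) with (2.77)–(2.80) and §3 (3.2)–(3.8)): for a tree weight `wt`, `V = Σ_{m' ∈ degs} Σ_Y K_{m'}(Y) ψ(Y)` with
`wt`-weighted anchored `L¹` norms `≤ N(m')`, a charged covariance in Gram form on the mixed pairs with constant `κ` and
one-copy row and column sums of `‖C(X,Y)‖ wt{X,Y}` at most `α`, and any positive `λ_δ`: one output label pinned and the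
others summed against the weight of the output label set, `Σ_{W : W_i = w} wt(W) ‖kernel_r 𝓔ᵀ_C(V; n) (W)‖ ≤ n · Σ_δ cumulantBound(δ)`.
[cite: BenfattoGiulianiMastropietro2006, (2.13)-(2.14), (2.77)-(2.80) and §3 (3.2)-(3.8)] -/
theorem sum_wt_norm_kernel_cumulantOf_le {E : Type*} [NormedAddCommGroup E] [InnerProductSpace 𝕜 E] (hwt : IsTreeWeight wt)
    (q : Γ → Bool) (hC : ∀ X Y, q X = q Y → C X Y = 0) (f g : Γ → E) {κ : ℝ} (hκ : 0 ≤ κ)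
    (hf : ∀ X, q X = true → ‖f X‖ ≤ κ) (hg : ∀ Y, q Y = false → ‖g Y‖ ≤ κ)
    (hG : ∀ X Y, q X = true → q Y = false → contr 𝕜 C X Y = ⟪f X, g Y⟫_𝕜)
    (degs : Finset ℕ) (K : (m' : ℕ) → (Fin (2 * m') → Γ) → 𝕜) (N : ℕ → ℝ) (hN0 : ∀ m', 0 ≤ N m')
    (hN : ∀ m' (j : Fin (2 * m')) (w : Γ), ∑ Y ∈ univ.filter (fun Y : Fin (2 * m') → Γ => Y j = w), ‖K m' Y‖ * wt (univ.image Y) ≤ N m')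
    {α : ℝ} (hα : 0 ≤ α) (hrow : ∀ X, ∑ Y, ‖C X Y‖ * wt {X, Y} ≤ α) (hcol : ∀ Y, ∑ X, ‖C X Y‖ * wt {X, Y} ≤ α)
    (lam : (Fin n → ℕ) → ℝ) (hlam : ∀ δ, 0 < lam δ) (hn : 0 < n) {r : ℕ} (i : Fin r) (w : Γ) :
    ∑ W ∈ univ.filter (fun W : Fin r → Γ => W i = w), wt (univ.image W) *
        ‖kernel 𝕜 ((cumulantOf (fun k => evenGaussConv 𝕜 C (vertexOf 𝕜 degs K ^ k)) n : evenPart 𝕜 Γ) : GrassmannAlgebra 𝕜 Γ) r W‖ ≤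
      (n : ℝ) * ∑ δ ∈ Fintype.piFinset (fun _ : Fin n => degs),
        (if r + 2 * (n - 1) ≤ ∑ a, 2 * δ a then cumulantBound n κ α (lam δ) N r δ else 0) := by
  set C' : Matrix (Fin n × Γ) (Fin n × Γ) 𝕜 := C.submatrix Prod.snd Prod.snd with hC'
  have huniv : (univ : Finset (Fin n)).Nonempty := ⟨⟨0, hn⟩, mem_univ _⟩
  -- the replica weight
  have hwt' : IsTreeWeight (fun S' : Finset (Fin n × Γ) => wt (S'.image Prod.snd)) := hwt.comap Prod.snd
  -- the degree-`δ` replica families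
  set U : (Fin n → ℕ) → evenPart 𝕜 (Fin n × Γ) := fun δ => ursellOf (convMoment 𝕜 C'
    (kernelVertex 𝕜 (deg := fun b : Fin n => 2 * δ b) (fun b => even_two_mul (δ b)) fun b => replicaKer 𝕜 (K (δ b)) b)) univ with hU
  -- replicas, collapse and multilinearity
  have hcum : ((cumulantOf (fun k => evenGaussConv 𝕜 C (vertexOf 𝕜 degs K ^ k)) n : evenPart 𝕜 Γ) : GrassmannAlgebra 𝕜 Γ) =
      ∑ δ ∈ Fintype.piFinset (fun _ : Fin n => degs), collapse 𝕜 (Prod.snd : Fin n × Γ → Γ) (U δ : GrassmannAlgebra 𝕜 (Fin n × Γ)) := by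
    have h1 := collapseEven_ursellOf_convMoment_eq_cumulantOf 𝕜 (Prod.snd : Fin n × Γ → Γ) C (replicaVertex 𝕜 degs K)
      (vertexOf 𝕜 degs K) (collapseEven_replicaVertex 𝕜 degs K) huniv
    rw [card_univ, Fintype.card_fin] at h1
    rw [← h1, coe_collapseEven]
    have h2 : ursellOf (convMoment 𝕜 C' (replicaVertex 𝕜 degs K)) univ = ∑ δ ∈ Fintype.piFinset (fun _ : Fin n => degs), U δ := by
      have h := ursellOf_convMoment_eq_sum_piFinset 𝕜 C' (Prod.fst : Fin n × Γ → Fin n) (fun _ : Fin n => degs)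
        (fun a m' => kernelVertex 𝕜 (deg := fun _ : Fin n => 2 * m') (fun _ => even_two_mul m') (fun b => replicaKer 𝕜 (K m') b) a)
        (fun a m' => coe_kernelVertex_replicaKer_mem 𝕜 m' (K m') a) ⟨0, hn⟩
      exact h
    rw [← hC', h2, AddSubmonoidClass.coe_finsetSum, map_sum]
  -- the weighted bound per degree assignment and pinned copy
  have hδ : ∀ (δ : Fin n → ℕ) (b : Fin n), ∑ W' ∈ univ.filter (fun W' : Fin r → Fin n × Γ => W' i = (b, w)),
      wt ((univ.image W').image Prod.snd) * ‖kernel 𝕜 (U δ : GrassmannAlgebra 𝕜 (Fin n × Γ)) r W'‖ ≤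
        if r + 2 * (n - 1) ≤ ∑ a, 2 * δ a then cumulantBound n κ α (lam δ) N r δ else 0 := by
    intro δ b
    have hC'' : ∀ X' Y' : Fin n × Γ, q X'.2 = q Y'.2 → C' X' Y' = 0 := fun X' Y' h => hC _ _ h
    have hG' : ∀ X' Y' : Fin n × Γ, q X'.2 = true → q Y'.2 = false → contr 𝕜 C' X' Y' = ⟪f X'.2, g Y'.2⟫_𝕜 :=
      fun X' Y' h1 h2 => by rw [hC', contr_submatrix]; exact hG _ _ h1 h2
    have hKs : ∀ (v : Fin n) (Yv : Fin (2 * δ v) → Fin n × Γ), replicaKer 𝕜 (K (δ v)) v Yv ≠ 0 → ∀ j, (Yv j).1 = v :=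
      fun v Yv h j => replicaKer_support 𝕜 (K (δ v)) v Yv h j
    split_ifs with hle
    · exact sum_wt_norm_kernel_ursellOf_kernelVertex_le C' (Prod.fst : Fin n × Γ → Fin n) (fun b => replicaKer 𝕜 (K (δ b)) b) hwt'
        (fun X' => q X'.2) hC'' (fun X' => f X'.2) (fun Y' => g Y'.2) hκ (fun X' h => hf _ h) (fun Y' h => hg _ h) hG'
        (fun b => even_two_mul (δ b)) hKs (fun u => N (δ u)) (fun u => hN0 _)
        (fun u j a' => sum_filter_wt_norm_replicaKer_le hwt (K (δ u)) u (hN (δ u)) j a') hα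
        (fun ℓ X' => sum_wt_norm_typeRestrict_submatrix_le C hα hrow ℓ X') (fun ℓ Y' => sum_wt_norm_typeRestrict_submatrix_le' C hα hcol ℓ Y')
        (hlam δ) i (b, w)
    · refine le_of_eq (sum_eq_zero fun W' _ => ?_)
      rw [hU]
      dsimp only
      rw [kernel_ursellOf_kernelVertex_eq_zero_of_lt C' (Prod.fst : Fin n × Γ → Fin n) (fun b => replicaKer 𝕜 (K (δ b)) b)
        (fun X' => q X'.2) hC'' (fun X' => f X'.2) (fun Y' => g Y'.2) hκ (fun X' h => hf _ h) (fun Y' h => hg _ h) hG'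
        (fun b => even_two_mul (δ b)) hKs ⟨0, hn⟩ (not_le.1 hle) W', norm_zero, mul_zero]
  -- assemble
  calc ∑ W ∈ univ.filter (fun W : Fin r → Γ => W i = w), wt (univ.image W) *
          ‖kernel 𝕜 ((cumulantOf (fun k => evenGaussConv 𝕜 C (vertexOf 𝕜 degs K ^ k)) n : evenPart 𝕜 Γ) : GrassmannAlgebra 𝕜 Γ) r W‖
      ≤ ∑ W ∈ univ.filter (fun W : Fin r → Γ => W i = w), ∑ δ ∈ Fintype.piFinset (fun _ : Fin n => degs),
          wt (univ.image W) * ‖kernel 𝕜 (collapse 𝕜 (Prod.snd : Fin n × Γ → Γ) (U δ : GrassmannAlgebra 𝕜 (Fin n × Γ))) r W‖ := by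
        refine sum_le_sum fun W _ => ?_
        rw [hcum, kernel_sum, ← mul_sum]
        exact mul_le_mul_of_nonneg_left (norm_sum_le _ _) (hwt.nonneg _)
    _ = ∑ δ ∈ Fintype.piFinset (fun _ : Fin n => degs), ∑ W ∈ univ.filter (fun W : Fin r → Γ => W i = w),
          wt (univ.image W) * ‖kernel 𝕜 (collapse 𝕜 (Prod.snd : Fin n × Γ → Γ) (U δ : GrassmannAlgebra 𝕜 (Fin n × Γ))) r W‖ := sum_comm
    _ ≤ ∑ δ ∈ Fintype.piFinset (fun _ : Fin n => degs), ∑ _b : Fin n,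
          (if r + 2 * (n - 1) ≤ ∑ a, 2 * δ a then cumulantBound n κ α (lam δ) N r δ else 0) :=
        sum_le_sum fun δ _ => (sum_filter_wt_norm_kernel_collapse_le hwt _ i w).trans (sum_le_sum fun b _ => hδ δ b)
    _ = (n : ℝ) * ∑ δ ∈ Fintype.piFinset (fun _ : Fin n => degs),
          (if r + 2 * (n - 1) ≤ ∑ a, 2 * δ a then cumulantBound n κ α (lam δ) N r δ else 0) := by
        rw [mul_sum]
        exact sum_congr rfl fun δ _ => by rw [sum_const, card_univ, Fintype.card_fin, nsmul_eq_mul]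

omit [DecidableEq Γ] in
/-- **The arithmetic of the standard choice `λ_δ = 1/(α(N_δ + n))`**:
`n · Σ_δ [r + 2(n-1) ≤ N_δ] cumulantBound(δ) ≤ n! · ρ^{-r} κ^{-2(n-1)} α^{n-1} eⁿ · (Σ_{m'} (e²(κ+ρ))^{2m'} N(m'))ⁿ`. [folklore] -/
theorem mul_sum_ite_cumulantBound_le {κ : ℝ} (hκ : 0 < κ) (degs : Finset ℕ) (N : ℕ → ℝ) (hN0 : ∀ m', 0 ≤ N m')
    {α : ℝ} (hα : 0 < α) {ρ : ℝ} (hρ : 0 < ρ) (hn : 0 < n) (r : ℕ) :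
    (n : ℝ) * ∑ δ ∈ Fintype.piFinset (fun _ : Fin n => degs),
        (if r + 2 * (n - 1) ≤ ∑ a, 2 * δ a then cumulantBound n κ α ((α * ((∑ a, (2 * δ a : ℝ)) + n))⁻¹) N r δ else 0) ≤
      (n.factorial : ℝ) * (ρ⁻¹ ^ r * κ⁻¹ ^ (2 * (n - 1)) * (α ^ (n - 1) * Real.exp n)) *
        (∑ m' ∈ degs, (Real.exp 2 * (κ + ρ)) ^ (2 * m') * N m') ^ n := by
  set c : ℝ := ρ⁻¹ ^ r * κ⁻¹ ^ (2 * (n - 1)) * (((n - 1).factorial : ℝ) * α ^ (n - 1) * Real.exp n) with hc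
  -- every degree assignment
  have hterm : ∀ δ : Fin n → ℕ,
      (if r + 2 * (n - 1) ≤ ∑ a, 2 * δ a then cumulantBound n κ α ((α * ((∑ a, (2 * δ a : ℝ)) + n))⁻¹) N r δ else 0) ≤
        c * ∏ a, (Real.exp 2 * (κ + ρ)) ^ (2 * δ a) * N (δ a) := by
    intro δ
    have hP : 0 ≤ ∏ a, (Real.exp 2 * (κ + ρ)) ^ (2 * δ a) * N (δ a) := prod_nonneg fun a _ => mul_nonneg (by positivity) (hN0 _)
    split_ifs with hle
    · rw [cumulantBound]
      have hA := choose_mul_pow_le (N := ∑ a, 2 * δ a) (r := r) (m := 2 * (n - 1)) hle hκ hρ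
      have hT := treeFactor_choice_le hn δ hα
      have hNprod : 0 ≤ ∏ a, N (δ a) := prod_nonneg fun a _ => hN0 _
      have hTnonneg : 0 ≤ ((α * ((∑ a, (2 * δ a : ℝ)) + n))⁻¹)⁻¹ ^ (n - 1) *
          ∏ ℓ : Sym2 (Fin n), (1 + (α * ((∑ a, (2 * δ a : ℝ)) + n))⁻¹ * (α * (pairDeg (fun a => 2 * δ a) ℓ : ℝ))) := by
        have hs : 0 ≤ ∑ a, (2 * δ a : ℝ) := sum_nonneg fun a _ => by positivity
        exact mul_nonneg (by positivity) (prod_nonneg fun ℓ _ => by positivity)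
      calc ((((r.factorial : ℝ))⁻¹ * ((∑ a, 2 * δ a).descFactorial r : ℝ)) * κ ^ ((∑ a, 2 * δ a) - (r + 2 * (n - 1))) * ∏ a, N (δ a)) *
            (((α * ((∑ a, (2 * δ a : ℝ)) + n))⁻¹)⁻¹ ^ (n - 1) *
              ∏ ℓ : Sym2 (Fin n), (1 + (α * ((∑ a, (2 * δ a : ℝ)) + n))⁻¹ * (α * (pairDeg (fun a => 2 * δ a) ℓ : ℝ))))
          ≤ ((ρ⁻¹ ^ r * κ⁻¹ ^ (2 * (n - 1)) * (κ + ρ) ^ (∑ a, 2 * δ a)) * ∏ a, N (δ a)) *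
              (((n - 1).factorial : ℝ) * α ^ (n - 1) * Real.exp (2 * (∑ a, (2 * δ a : ℝ)) + n)) :=
            mul_le_mul (mul_le_mul_of_nonneg_right hA hNprod) hT hTnonneg (by positivity)
        _ = c * ∏ a, (Real.exp 2 * (κ + ρ)) ^ (2 * δ a) * N (δ a) := by
            have hexp : Real.exp (2 * (∑ a, (2 * δ a : ℝ)) + n) = Real.exp n * ∏ a, Real.exp 2 ^ (2 * δ a) := by
              rw [Real.exp_add, mul_comm, mul_sum, Real.exp_sum]
              congr 1
              refine prod_congr rfl fun a _ => ?_
              rw [← Real.exp_nat_mul]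
              congr 1
              push_cast
              ring
            rw [hexp, ← prod_pow_eq_pow_sum, hc]
            simp only [mul_pow, prod_mul_distrib]
            ring
    · exact mul_nonneg (by positivity) hP
  -- sum over the degree assignments
  calc (n : ℝ) * ∑ δ ∈ Fintype.piFinset (fun _ : Fin n => degs),
          (if r + 2 * (n - 1) ≤ ∑ a, 2 * δ a then cumulantBound n κ α ((α * ((∑ a, (2 * δ a : ℝ)) + n))⁻¹) N r δ else 0)
      ≤ (n : ℝ) * ∑ δ ∈ Fintype.piFinset (fun _ : Fin n => degs), c * ∏ a, (Real.exp 2 * (κ + ρ)) ^ (2 * δ a) * N (δ a) :=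
        mul_le_mul_of_nonneg_left (sum_le_sum fun δ _ => hterm δ) (Nat.cast_nonneg n)
    _ = (n.factorial : ℝ) * (ρ⁻¹ ^ r * κ⁻¹ ^ (2 * (n - 1)) * (α ^ (n - 1) * Real.exp n)) *
          (∑ m' ∈ degs, (Real.exp 2 * (κ + ρ)) ^ (2 * m') * N m') ^ n := by
        rw [← mul_sum, sum_piFinset_prod_eq_pow degs fun m' => (Real.exp 2 * (κ + ρ)) ^ (2 * m') * N m', hc,
          ← Nat.mul_factorial_pred (Nat.pos_iff_ne_zero.1 hn), Nat.cast_mul]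
        ring

/-- **The decay-weighted `‖𝓔ᵀ_C(V; n)‖ ≤ n! Cⁿ ‖V‖_hⁿ` with explicit constants** (Benfatto–Giuliani–Mastropietro 2006,
(2.77)–(2.80) with §3 (3.2)–(3.8); Gentile–Mastropietro 2001, §4): for a tree weight `wt`, `V = Σ_{m' ∈ degs} Σ_Y K_{m'}(Y) ψ(Y)`
(degrees `2m'`, `wt`-weighted anchored `L¹` norms `≤ N(m')`), a charged covariance in Gram form on the mixed pairs with
constant `κ > 0` and one-copy row and column sums of `‖C(X,Y)‖ wt{X,Y}` at most `α > 0`, and an output field weight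
`ρ > 0`: one output label pinned and the others summed against the weight of the output label set,
`Σ_{W : W_i = w} wt(W) ‖kernel_r 𝓔ᵀ_C(V; n) (W)‖ ≤ n! · ρ^{-r} κ^{-2(n-1)} α^{n-1} eⁿ · (Σ_{m'} (e²(κ+ρ))^{2m'} N(m'))ⁿ`.
[cite: BenfattoGiulianiMastropietro2006, (2.77)-(2.80) and §3 (3.2)-(3.8)] -/
theorem sum_wt_norm_kernel_cumulantOf_le_pow {E : Type*} [NormedAddCommGroup E] [InnerProductSpace 𝕜 E] (hwt : IsTreeWeight wt)
    (q : Γ → Bool) (hC : ∀ X Y, q X = q Y → C X Y = 0) (f g : Γ → E) {κ : ℝ} (hκ : 0 < κ)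
    (hf : ∀ X, q X = true → ‖f X‖ ≤ κ) (hg : ∀ Y, q Y = false → ‖g Y‖ ≤ κ)
    (hG : ∀ X Y, q X = true → q Y = false → contr 𝕜 C X Y = ⟪f X, g Y⟫_𝕜)
    (degs : Finset ℕ) (K : (m' : ℕ) → (Fin (2 * m') → Γ) → 𝕜) (N : ℕ → ℝ) (hN0 : ∀ m', 0 ≤ N m')
    (hN : ∀ m' (j : Fin (2 * m')) (w : Γ), ∑ Y ∈ univ.filter (fun Y : Fin (2 * m') → Γ => Y j = w), ‖K m' Y‖ * wt (univ.image Y) ≤ N m')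
    {α : ℝ} (hα : 0 < α) (hrow : ∀ X, ∑ Y, ‖C X Y‖ * wt {X, Y} ≤ α) (hcol : ∀ Y, ∑ X, ‖C X Y‖ * wt {X, Y} ≤ α) {ρ : ℝ} (hρ : 0 < ρ)
    (hn : 0 < n) {r : ℕ} (i : Fin r) (w : Γ) :
    ∑ W ∈ univ.filter (fun W : Fin r → Γ => W i = w), wt (univ.image W) *
        ‖kernel 𝕜 ((cumulantOf (fun k => evenGaussConv 𝕜 C (vertexOf 𝕜 degs K ^ k)) n : evenPart 𝕜 Γ) : GrassmannAlgebra 𝕜 Γ) r W‖ ≤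
      (n.factorial : ℝ) * (ρ⁻¹ ^ r * κ⁻¹ ^ (2 * (n - 1)) * (α ^ (n - 1) * Real.exp n)) *
        (∑ m' ∈ degs, (Real.exp 2 * (κ + ρ)) ^ (2 * m') * N m') ^ n :=
  (sum_wt_norm_kernel_cumulantOf_le C hwt q hC f g hκ.le hf hg hG degs K N hN0 hN hα.le hrow hcol
    (fun δ => (α * ((∑ a, (2 * δ a : ℝ)) + n))⁻¹) (fun δ => by positivity) hn i w).trans
    (mul_sum_ite_cumulantBound_le hκ degs N hN0 hα hρ hn r)

end Main

end Literature.MathematicalPhysics.QuantumLattice
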